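import Mathlib.RingTheory.Nullstellensatz
import Mathlib.RingTheory.Localization.FractionRing
import Mathlib.RingTheory.AlgebraicIndependent.TranscendenceBasis
import Mathlib.RingTheory.Algebraic.Basic
import Mathlib.LinearAlgebra.Matrix.Rank
import Literature.NumberTheory.Transcendental.ExpVarieties
import Literature.NumberTheory.Transcendental.ZilberField
import Literature.NumberTheory.Transcendental.ExpVarietiesDimension
import Literature.NumberTheory.Transcendental.ZilberGenericClosedness
import HarnessLib

/-!
# Bays–Kirby 2018, Def. 10.3 (remark): EAC in the single-point form gives Zariski density

Proof of the named fact `Literature.NumberTheory.Transcendental.BaysKirby2018_gammaPoints_dense_of_isExpAlgClosed`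
(`ZilberGenericClosedness.lean`): in an algebraically closed exponential field of characteristic
zero which is exponentially-algebraically closed in the single-point form `Literature.NumberTheory.Transcendental.IsExpAlgClosed`
(every irreducible, free and rotund `V ⊆ Gⁿ` of dimension `n` has a point `(x, exp x)`), the
points `(x, exp x)` of every such `V` are Zariski dense in `V` — Bays–Kirby 2018, remark after
Def. 10.3: "Using the classical Rabinovich trick, one can easily show this axiom scheme is
equivalent to the existence of a single point `β ∈ V(F) ∩ Γ(F)ⁿ`, for every such `V`."

## The Rabinowitsch trick (proof)

Let `V = W₀ ∩ Gⁿ`, `W₀ = Z(P)` irreducible (`P` prime), free, rotund, `dim V = n`, and let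
`f ∈ F[X, Y]` vanish on `V ∩ Γⁿ`; suppose `f ∉ P`. In `G^{n+1}` consider
`V⁺ = {(x, t ; y, s) : (x, y) ∈ V, f(x, y) s = 1}`: it is irreducible of dimension `n + 1` (its
coordinate ring is `F[V]_f[T]`), free (the new additive coordinate `t` is unconstrained; a
multiplicative dependence would make `f` a monomial up to a constant on `V`, without zeros on
`V`, while EAC gives a Γ-point of `V`, a zero of `f`) and rotund (row-reduce `M ∈ M_{n+1}(ℤ)` so
that only one row involves the last column: the other rows act on `V`, which is rotund, and the
remaining row contributes the transcendental `t`). EAC in `G^{n+1}` gives `(x, t ; eˣ, eᵗ) ∈ V⁺`,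
so `(x, eˣ) ∈ V ∩ Γⁿ` with `f(x, eˣ) eᵗ = 1`, contradicting `f(x, eˣ) = 0`.

We realise `V⁺` as `Z(Q)`, `Q` the kernel of evaluation at the point
`ξ⁺ = (ξ_x, T ; ξ_y, f(ξ)⁻¹)` of the field `E = F(V)(T)`, `ξ` the generic point of `V`
(`ExpVarietiesDimension.lean`); `ξ⁺` is then a generic point of `Z(Q)` by construction, which
gives irreducibility, the dimension (a transcendence basis of `E` over `F` inside the
coordinates) and, through `Literature.NumberTheory.Transcendental.zariskiDim_image_matrixAct_eq`, rotundity, by transcendence degree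
computations in `E`.

## References

* M. Bays, J. Kirby, *Pseudo-exponential maps, variants, and quasiminimality*, Algebra & Number
  Theory 12 (2018) 493–549, Def. 10.3 and the remark following it; Def. 7.1, Prop. 7.3.
-/

noncomputable section

open MvPolynomial Set

universe u

namespace Literature.NumberTheory.Transcendental

namespace Rabinowitsch

variable {F : Type u} [Field F]
variable {n : ℕ} (P : Ideal (MvPolynomial (Fin n ⊕ Fin n) F)) [P.IsPrime]
  (f : MvPolynomial (Fin n ⊕ Fin n) F)

/-! ### The field `E = F(V)(T)` and the point `ξ⁺` -/

/-- The polynomial ring `F(V)[T]` over the function field of `V = Z(P)`. [folklore] -/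
abbrev PolyRing : Type u := Polynomial (zeroLocusFunctionField P)

/-- The field `E = F(V)(T) = Frac (F(V)[T])`. [folklore] -/
abbrev RabField : Type u := FractionRing (PolyRing P)

/-- The generic point `ξ` of `V` viewed in `E = F(V)(T)`. [folklore] -/
def xiV : Fin n ⊕ Fin n → RabField P :=
  fun j => algebraMap (zeroLocusFunctionField P) (RabField P) (genericPt P j)

/-- The transcendental `T ∈ E`. [folklore] -/
def tGen : RabField P := algebraMap (PolyRing P) (RabField P) Polynomial.X

/-- The `F`-algebra map `F(V) → E`. [folklore] -/
def toRab : zeroLocusFunctionField P →ₐ[F] RabField P :=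
  IsScalarTower.toAlgHom F (zeroLocusFunctionField P) (RabField P)

omit [P.IsPrime] in
/-- `toRab` is the structure map. [folklore] -/
theorem toRab_apply (x : zeroLocusFunctionField P) :
    toRab P x = algebraMap (zeroLocusFunctionField P) (RabField P) x := rfl

omit [P.IsPrime] in
/-- `F(V) → E` is injective. [folklore] -/
theorem toRab_injective : Function.Injective (toRab P) := by
  intro x y h
  rw [toRab_apply, toRab_apply, IsScalarTower.algebraMap_apply (zeroLocusFunctionField P) (PolyRing P) (RabField P),
    IsScalarTower.algebraMap_apply (zeroLocusFunctionField P) (PolyRing P) (RabField P)] at h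
  exact Polynomial.C_injective (IsFractionRing.injective (PolyRing P) (RabField P) h)

omit [P.IsPrime] in
/-- `ξ`, viewed in `E`, is still a generic point of `V` over `F`. [folklore] -/
theorem isGenericPt_xiV : IsGenericPt P (xiV P) :=
  (isGenericPt_genericPt P).map P (toRab P) (toRab_injective P)

omit [P.IsPrime] in
/-- `T` is transcendental over `F(V)`. [folklore] -/
theorem transcendental_tGen : Transcendental (zeroLocusFunctionField P) (tGen P) := by
  intro halg
  have hinj : Function.Injective (algebraMap (PolyRing P) (RabField P)) :=
    IsFractionRing.injective (PolyRing P) (RabField P)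
  have : IsAlgebraic (zeroLocusFunctionField P) (Polynomial.X : PolyRing P) := by
    rw [tGen] at halg
    exact (isAlgebraic_algebraMap_iff hinj).1 halg
  exact Polynomial.transcendental_X (R := zeroLocusFunctionField P) this

/-- `T` is not in (the image of) `F(V)`. [folklore] -/
theorem tGen_notMem_range : tGen P ∉ Set.range (algebraMap (zeroLocusFunctionField P) (RabField P)) := by
  rintro ⟨x, hx⟩
  exact transcendental_tGen P (hx ▸ isAlgebraic_algebraMap x)

/-- **The point `ξ⁺ = (ξ_x, T ; ξ_y, f(ξ)⁻¹) ∈ E^{(n+1) ⊕ (n+1)}`**, generic point of the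
Rabinowitsch variety `V⁺`. [cite: BaysKirby2018ANT, Def. 10.3 (remark)] -/
def rabPt : Fin (n + 1) ⊕ Fin (n + 1) → RabField P :=
  Sum.elim (Fin.snoc (fun j => xiV P (Sum.inl j)) (tGen P))
    (Fin.snoc (fun j => xiV P (Sum.inr j)) (aeval (xiV P) f)⁻¹)

/-- First additive coordinates of `ξ⁺`. [folklore] -/
@[simp] theorem rabPt_inl_castSucc (j : Fin n) :
    rabPt P f (Sum.inl (Fin.castSucc j)) = xiV P (Sum.inl j) := by
  simp [rabPt]

/-- Last additive coordinate of `ξ⁺` is `T`. [folklore] -/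
@[simp] theorem rabPt_inl_last : rabPt P f (Sum.inl (Fin.last n)) = tGen P := by
  simp [rabPt]

/-- First multiplicative coordinates of `ξ⁺`. [folklore] -/
@[simp] theorem rabPt_inr_castSucc (j : Fin n) :
    rabPt P f (Sum.inr (Fin.castSucc j)) = xiV P (Sum.inr j) := by
  simp [rabPt]

/-- Last multiplicative coordinate of `ξ⁺` is `f(ξ)⁻¹`. [folklore] -/
@[simp] theorem rabPt_inr_last : rabPt P f (Sum.inr (Fin.last n)) = (aeval (xiV P) f)⁻¹ := by
  simp [rabPt]

/-- **The ideal `Q` of the Rabinowitsch variety**: the kernel of evaluation at `ξ⁺` (a prime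
ideal of `F[X⁺, Y⁺]`). [cite: BaysKirby2018ANT, Def. 10.3 (remark)] -/
def rabIdeal : Ideal (MvPolynomial (Fin (n + 1) ⊕ Fin (n + 1)) F) :=
  RingHom.ker (aeval (rabPt P f) : MvPolynomial (Fin (n + 1) ⊕ Fin (n + 1)) F →ₐ[F] RabField P)

/-- `Q` is prime (kernel of a map into a field). [folklore] -/
instance rabIdeal_isPrime : (rabIdeal P f).IsPrime := RingHom.ker_isPrime _

/-- `ξ⁺` is a generic point of `Z(Q)` (by definition of `Q`). [folklore] -/
theorem isGenericPt_rabPt : IsGenericPt (rabIdeal P f) (rabPt P f) := fun _ => Iff.rfl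

/-! ### Points of `Z(Q)` lie over points of `V` with `f · s = 1` -/

/-- The embedding of variables `F[X, Y] → F[X⁺, Y⁺]` (first `n` coordinates of each block).
[folklore] -/
def liftVar : Fin n ⊕ Fin n → Fin (n + 1) ⊕ Fin (n + 1) := Sum.map Fin.castSucc Fin.castSucc

/-- Restriction of a point of `F^{(n+1) ⊕ (n+1)}` to the first `n` coordinates of each block.
[folklore] -/
def resPt {R : Type*} (z : Fin (n + 1) ⊕ Fin (n + 1) → R) : Fin n ⊕ Fin n → R := z ∘ liftVar

/-- `ξ⁺` restricts to `ξ`. [folklore] -/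
@[simp] theorem resPt_rabPt : resPt (rabPt P f) = xiV P := by
  ext (j | j) <;> simp [resPt, liftVar]

omit [P.IsPrime] in
/-- Evaluating a lifted polynomial at `z` is evaluating at the restricted point. [folklore] -/
theorem aeval_rename_liftVar {R : Type*} [CommRing R] [Algebra F R]
    (z : Fin (n + 1) ⊕ Fin (n + 1) → R) (p : MvPolynomial (Fin n ⊕ Fin n) F) :
    aeval z (rename liftVar p) = aeval (resPt z) p := by
  rw [aeval_rename]; rfl

/-- Lifts of elements of `P` lie in `Q`. [folklore] -/
theorem rename_mem_rabIdeal {p : MvPolynomial (Fin n ⊕ Fin n) F} (hp : p ∈ P) :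
    rename liftVar p ∈ rabIdeal P f := by
  rw [rabIdeal, RingHom.mem_ker]
  change aeval (rabPt P f) (rename liftVar p) = 0
  rw [aeval_rename_liftVar, resPt_rabPt]
  exact (isGenericPt_xiV P p).2 hp

omit [P.IsPrime] in
/-- `f(ξ) ≠ 0` in `E` when `f ∉ P`. [folklore] -/
theorem aeval_xiV_ne_zero (hf : f ∉ P) : aeval (xiV P) f ≠ 0 :=
  fun h => hf ((isGenericPt_xiV P f).1 h)

/-- The Rabinowitsch relation `Y⁺_{last} · f − 1 ∈ Q`. [cite: BaysKirby2018ANT, Def. 10.3 (remark)] -/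
theorem rabRel_mem_rabIdeal (hf : f ∉ P) :
    X (Sum.inr (Fin.last n)) * rename liftVar f - 1 ∈ rabIdeal P f := by
  rw [rabIdeal, RingHom.mem_ker]
  change aeval (rabPt P f) (X (Sum.inr (Fin.last n)) * rename liftVar f - 1) = 0
  rw [map_sub, map_mul, aeval_X, rabPt_inr_last, aeval_rename_liftVar, resPt_rabPt, map_one,
    inv_mul_cancel₀ (aeval_xiV_ne_zero P f hf), sub_self]

/-- **Points of `Z(Q)` project into `V` and satisfy `s · f(x, y) = 1`.** [cite: BaysKirby2018ANT, Def. 10.3 (remark)] -/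
theorem resPt_mem_of_mem_zeroLocus (hf : f ∉ P) {z : Fin (n + 1) ⊕ Fin (n + 1) → F}
    (hz : z ∈ zeroLocus F (rabIdeal P f)) :
    resPt z ∈ zeroLocus F P ∧ z (Sum.inr (Fin.last n)) * aeval (resPt z) f = 1 := by
  rw [mem_zeroLocus_iff] at hz
  refine ⟨?_, ?_⟩
  · rw [mem_zeroLocus_iff]
    intro p hp
    rw [← aeval_rename_liftVar]
    exact hz _ (rename_mem_rabIdeal P f hp)
  · have := hz _ (rabRel_mem_rabIdeal P f hf)
    rwa [map_sub, map_mul, aeval_X, aeval_rename_liftVar, map_one, sub_eq_zero] at this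

/-- `ξ ∈ E` lies in the torus when `V` meets the torus. [folklore] -/
theorem xiV_mem_torusLocus (hne : (zeroLocus F P ∩ torusLocus F n).Nonempty) :
    xiV P ∈ torusLocus (RabField P) n :=
  (isGenericPt_xiV P).mem_torusLocus P (X_inr_notMem_of_nonempty P hne)

/-- `ξ⁺` lies in the torus (when `V` meets the torus and `f ∉ P`). [folklore] -/
theorem rabPt_mem_torusLocus (hne : (zeroLocus F P ∩ torusLocus F n).Nonempty) (hf : f ∉ P) :
    rabPt P f ∈ torusLocus (RabField P) (n + 1) := by
  intro i
  refine Fin.lastCases ?_ (fun j => ?_) i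
  · rw [rabPt_inr_last]
    exact inv_ne_zero (aeval_xiV_ne_zero P f hf)
  · rw [rabPt_inr_castSucc]
    exact xiV_mem_torusLocus P hne j

/-! ### `Z(Q)` is irreducible, meets the torus, and has dimension `n + 1` -/

variable [IsAlgClosed F]

/-- `Z(Q)` is irreducible closed. [folklore] -/
theorem isIrreducibleClosed_zeroLocus_rabIdeal :
    IsIrreducibleClosed F (zeroLocus F (rabIdeal P f)) :=
  isIrreducibleClosed_zeroLocus _

/-- **`Z(Q)` meets the torus**: otherwise `∏ Y⁺ᵢ` would vanish on `Z(Q)`, i.e. lie in `Q`, but its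
value at `ξ⁺` is a product of non-zero elements of `E`. [cite: BaysKirby2018ANT, Def. 10.3 (remark)] -/
theorem nonempty_zeroLocus_rabIdeal (hne : (zeroLocus F P ∩ torusLocus F n).Nonempty) (hf : f ∉ P) :
    (zeroLocus F (rabIdeal P f) ∩ torusLocus F (n + 1)).Nonempty := by
  by_contra hemp
  rw [not_nonempty_iff_eq_empty] at hemp
  have hprod : (∏ i, X (Sum.inr i) : MvPolynomial (Fin (n + 1) ⊕ Fin (n + 1)) F) ∈
      vanishingIdeal F (zeroLocus F (rabIdeal P f)) := by
    rw [mem_vanishingIdeal_iff]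
    intro z hz
    have hzT : z ∉ torusLocus F (n + 1) := fun h => by
      have : z ∈ zeroLocus F (rabIdeal P f) ∩ torusLocus F (n + 1) := ⟨hz, h⟩
      rw [hemp] at this
      exact this
    simp only [mem_torusLocus_iff, not_forall, not_not] at hzT
    obtain ⟨i, hi⟩ := hzT
    rw [map_prod]
    simp only [aeval_X]
    exact Finset.prod_eq_zero (Finset.mem_univ i) hi
  rw [MvPolynomial.IsPrime.vanishingIdeal_zeroLocus (rabIdeal P f)] at hprod
  have : aeval (rabPt P f) (∏ i, X (Sum.inr i) : MvPolynomial (Fin (n + 1) ⊕ Fin (n + 1)) F) = 0 :=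
    (isGenericPt_rabPt P f _).2 hprod
  rw [map_prod] at this
  simp only [aeval_X] at this
  exact (Finset.prod_ne_zero_iff.2 fun i _ => rabPt_mem_torusLocus P f hne hf i) this

omit [IsAlgClosed F] in
/-- Elements of `F(V)` pushed to `E` are values at `ξ⁺` of lifted polynomials: for `p ∈ F[X, Y]`,
`p(ξ) = (rename liftVar p)(ξ⁺)`. [folklore] -/
theorem aeval_xiV_eq (p : MvPolynomial (Fin n ⊕ Fin n) F) :
    aeval (xiV P) p = aeval (rabPt P f) (rename liftVar p) := by
  rw [aeval_rename_liftVar, resPt_rabPt]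

omit [P.IsPrime] [IsAlgClosed F] in
/-- `p(ξ)` in `E` is the image of the class of `p`. [folklore] -/
theorem aeval_xiV_eq_algebraMap (p : MvPolynomial (Fin n ⊕ Fin n) F) :
    aeval (xiV P) p = algebraMap (zeroLocusFunctionField P) (RabField P)
      (algebraMap (zeroLocusCoordRing P) (zeroLocusFunctionField P) (Ideal.Quotient.mk P p)) := by
  have : xiV P = (toRab P) ∘ genericPt P := rfl
  rw [this, ← aeval_genericPt]
  change aeval (fun j => toRab P (genericPt P j)) p = _
  rw [← MvPolynomial.comp_aeval, AlgHom.comp_apply]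
  rfl

/-- **`trdeg_F E = n + 1`** when `dim V = n`: a transcendence basis of `F[V]` together with `T`
is a transcendence basis of `E = F(V)(T)` over `F`; moreover all its elements are values at `ξ⁺`
of polynomials. [folklore] -/
theorem exists_isTranscendenceBasis_rabField (hdim : zariskiDim F (zeroLocus F P) = n) :
    ∃ (ι : Type u) (b : ι → RabField P), IsTranscendenceBasis F b ∧ Cardinal.mk ι = (n + 1 : ℕ) ∧
      ∀ i, ∃ q : MvPolynomial (Fin (n + 1) ⊕ Fin (n + 1)) F, aeval (rabPt P f) q = b i := by
  classical
  -- `trdeg_F F[V] = n`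
  have htr : Algebra.trdeg F (zeroLocusCoordRing P) = n := by
    have h := zariskiDim_zeroLocus_eq_trdeg (F := F) P
    rw [hdim] at h
    have h' : (Cardinal.toNat (Algebra.trdeg F (zeroLocusCoordRing P)) : WithBot ℕ∞) = n := h.symm
    have h'' : Cardinal.toNat (Algebra.trdeg F (zeroLocusCoordRing P)) = n := by exact_mod_cast h'
    rw [Literature.RingTheory.KrullDimension.trdeg_eq_toNat F (zeroLocusCoordRing P), h'']
  haveI : FaithfulSMul F (zeroLocusCoordRing P) :=
    (faithfulSMul_iff_algebraMap_injective F (zeroLocusCoordRing P)).2 (algebraMap F (zeroLocusCoordRing P)).injective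
  obtain ⟨s, hs⟩ := exists_isTranscendenceBasis F (zeroLocusCoordRing P)
  haveI : Algebra.IsAlgebraic (zeroLocusCoordRing P) (zeroLocusFunctionField P) :=
    IsLocalization.isAlgebraic (zeroLocusFunctionField P) (nonZeroDivisors (zeroLocusCoordRing P))
  have hsK := hs.algebraMap_comp (A := zeroLocusFunctionField P)
  have hX : IsTranscendenceBasis (zeroLocusFunctionField P) (fun _ : Unit => (Polynomial.X : PolyRing P)) :=
    IsTranscendenceBasis.polynomial Unit (zeroLocusFunctionField P)
  have hD := hsK.sumElim_comp hX
  haveI : Algebra.IsAlgebraic (PolyRing P) (RabField P) :=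
    IsLocalization.isAlgebraic (RabField P) (nonZeroDivisors (PolyRing P))
  haveI : FaithfulSMul (PolyRing P) (RabField P) :=
    (faithfulSMul_iff_algebraMap_injective (PolyRing P) (RabField P)).2
      (IsFractionRing.injective (PolyRing P) (RabField P))
  have hE := hD.algebraMap_comp (A := RabField P)
  refine ⟨Unit ⊕ ↥s, _, hE, ?_, ?_⟩
  · have hcs : Cardinal.mk ↥s = n := by rw [hs.cardinalMk_eq_trdeg, htr]
    rw [Cardinal.mk_sum, hcs]
    simp only [Cardinal.mk_fintype, Fintype.card_unit, Nat.cast_one, Cardinal.lift_one,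
      Cardinal.lift_natCast]
    rw [add_comm]; norm_cast
  · rintro (u | ⟨a, ha⟩)
    · refine ⟨X (Sum.inl (Fin.last n)), ?_⟩
      rw [aeval_X, rabPt_inl_last]
      rfl
    · obtain ⟨p, rfl⟩ := Ideal.Quotient.mk_surjective a
      refine ⟨rename liftVar p, ?_⟩
      rw [← aeval_xiV_eq, aeval_xiV_eq_algebraMap]
      simp only [Sum.elim_inr, Function.comp_apply]
      rw [IsScalarTower.algebraMap_apply (zeroLocusFunctionField P) (PolyRing P) (RabField P)]

/-- **`dim Z(Q) = n + 1`** when `dim V = n`. [cite: BaysKirby2018ANT, Def. 10.3 (remark)] -/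
theorem zariskiDim_zeroLocus_rabIdeal (hdim : zariskiDim F (zeroLocus F P) = n) :
    zariskiDim F (zeroLocus F (rabIdeal P f)) = (n + 1 : ℕ) := by
  obtain ⟨ι, b, hb, hcard, hmem⟩ := exists_isTranscendenceBasis_rabField P f hdim
  set φ := (aeval (rabPt P f) : MvPolynomial (Fin (n + 1) ⊕ Fin (n + 1)) F →ₐ[F] RabField P)
    with hφ
  have hker : rabIdeal P f = RingHom.ker φ := rfl
  rw [hker, zariskiDim_zeroLocus_ker φ]
  haveI : Algebra.FiniteType F φ.range :=
    Algebra.FiniteType.of_surjective φ.rangeRestrict (AlgHom.rangeRestrict_surjective φ)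
  have hfin : Algebra.trdeg F φ.range = Cardinal.toNat (Algebra.trdeg F φ.range) :=
    Literature.RingTheory.KrullDimension.trdeg_eq_toNat F φ.range
  -- upper bound
  have hE : Algebra.trdeg F (RabField P) = (n + 1 : ℕ) := by rw [← hb.cardinalMk_eq_trdeg, hcard]
  have hup : Algebra.trdeg F φ.range ≤ (n + 1 : ℕ) := by
    rw [← hE]; exact trdeg_le_of_injective φ.range.val Subtype.val_injective
  -- lower bound: the basis lies in the range
  choose q hq using hmem
  let w : ι → φ.range := fun i => ⟨φ (q i), ⟨q i, rfl⟩⟩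
  have hwb : φ.range.val ∘ w = b := funext fun i => hq i
  have hw : AlgebraicIndependent F w := AlgebraicIndependent.of_comp φ.range.val (hwb ▸ hb.1)
  have hlow : ((n + 1 : ℕ) : Cardinal) ≤ Algebra.trdeg F φ.range := by
    rw [← hcard]; exact hw.cardinalMk_le_trdeg
  have : Algebra.trdeg F φ.range = (n + 1 : ℕ) := le_antisymm hup hlow
  rw [this, Cardinal.toNat_natCast]

/-! ### Freeness of `Z(Q)` -/

omit [IsAlgClosed F] in
/-- Values `p(ξ) ∈ E` lie in the subfield `F(V) ⊆ E`. [folklore] -/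
theorem aeval_xiV_mem_fieldRange (p : MvPolynomial (Fin n ⊕ Fin n) F) :
    aeval (xiV P) p ∈ (algebraMap (zeroLocusFunctionField P) (RabField P)).fieldRange := by
  rw [aeval_xiV_eq_algebraMap, RingHom.mem_fieldRange]
  exact ⟨_, rfl⟩

omit [IsAlgClosed F] in
/-- `T ∉ F(V)` (subfield form). [folklore] -/
theorem tGen_notMem_fieldRange :
    tGen P ∉ (algebraMap (zeroLocusFunctionField P) (RabField P)).fieldRange := by
  intro h
  rw [RingHom.mem_fieldRange] at h
  exact tGen_notMem_range P h

/-- **`Z(Q) ∩ G^{n+1}` is additively free** if `V` is: an additive relation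
`∑ mᵢ xᵢ = c` on `Z(Q) ∩ G^{n+1}` lies in `Q`, so holds at `ξ⁺`; the coefficient of `T` must vanish
(`T ∉ F(V)`), and then the relation descends to `V` through the generic point `ξ`.
[cite: BaysKirby2018ANT, Def. 10.3 (remark)] -/
theorem isAddFree_zeroLocus_rabIdeal [CharZero F] (hne : (zeroLocus F P ∩ torusLocus F n).Nonempty)
    (hf : f ∉ P) (hadd : IsAddFree F n (zeroLocus F P ∩ torusLocus F n)) :
    IsAddFree F (n + 1) (zeroLocus F (rabIdeal P f) ∩ torusLocus F (n + 1)) := by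
  classical
  rintro m hm ⟨c, hc⟩
  -- the relation as a polynomial, and its part on the first `n` coordinates
  set ℓ₀ : MvPolynomial (Fin n ⊕ Fin n) F :=
    ∑ j : Fin n, C ((m (Fin.castSucc j) : ℤ) : F) * X (Sum.inl j) - C c with hℓ₀
  set ℓ : MvPolynomial (Fin (n + 1) ⊕ Fin (n + 1)) F :=
    ∑ i, C ((m i : ℤ) : F) * X (Sum.inl i) - C c with hℓ
  have hℓeq : ℓ = rename liftVar ℓ₀ + C ((m (Fin.last n) : ℤ) : F) * X (Sum.inl (Fin.last n)) := by
    simp only [hℓ, hℓ₀, map_sub, map_sum, map_mul, rename_C, rename_X, Fin.sum_univ_castSucc]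
    simp only [liftVar, Sum.map_inl]
    ring
  -- `ℓ ∈ Q`
  have hℓQ : ℓ ∈ rabIdeal P f := by
    rw [← vanishingIdeal_zeroLocus_inter_torusLocus (rabIdeal P f)
      (nonempty_zeroLocus_rabIdeal P f hne hf), mem_vanishingIdeal_iff]
    intro z hz
    simp only [hℓ, map_sub, map_sum, map_mul, aeval_C, aeval_X, Algebra.algebraMap_self,
      RingHom.id_apply]
    rw [hc z hz, sub_self]
  have h0 : aeval (xiV P) ℓ₀ + algebraMap F (RabField P) ((m (Fin.last n) : ℤ) : F) * tGen P = 0 := by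
    have := (isGenericPt_rabPt P f ℓ).2 hℓQ
    rwa [hℓeq, map_add, map_mul, aeval_C, aeval_X, rabPt_inl_last, ← aeval_xiV_eq] at this
  by_cases hlast : m (Fin.last n) = 0
  · -- the relation descends to `V`
    have hm' : (fun j => m (Fin.castSucc j)) ≠ 0 := by
      intro h
      apply hm
      funext i
      refine Fin.lastCases ?_ (fun j => ?_) i
      · exact hlast
      · exact congrFun h j
    refine hadd _ hm' ⟨c, fun z hz => ?_⟩
    have hℓ₀P : ℓ₀ ∈ P := by
      rw [hlast, Int.cast_zero, map_zero, zero_mul, add_zero] at h0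
      exact (isGenericPt_xiV P ℓ₀).1 h0
    have := (mem_zeroLocus_iff.1 hz.1) _ hℓ₀P
    simp only [hℓ₀, map_sub, map_sum, map_mul, aeval_C, aeval_X, Algebra.algebraMap_self,
      RingHom.id_apply] at this
    exact sub_eq_zero.1 this
  · -- `T` would lie in `F(V)`
    exfalso
    apply tGen_notMem_fieldRange P
    have hmne : algebraMap F (RabField P) ((m (Fin.last n) : ℤ) : F) ≠ 0 := by
      rw [map_ne_zero_iff _ (algebraMap F (RabField P)).injective]
      exact_mod_cast hlast
    have : tGen P = -(aeval (xiV P) ℓ₀) * (algebraMap F (RabField P) ((m (Fin.last n) : ℤ) : F))⁻¹ := by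
      field_simp
      linear_combination h0
    rw [this]
    refine Subfield.mul_mem _ (Subfield.neg_mem _ (aeval_xiV_mem_fieldRange P ℓ₀))
      (Subfield.inv_mem _ ?_)
    rw [IsScalarTower.algebraMap_apply F (zeroLocusFunctionField P) (RabField P), RingHom.mem_fieldRange]
    exact ⟨_, rfl⟩

/-! ### Laurent monomials and binomial equations -/

section Binomial

variable {R : Type*} [Field R]

/-- For a point of the torus, `∏ zᵢ^{mᵢ} = (∏ zᵢ^{mᵢ⁺}) (∏ zᵢ^{mᵢ⁻})⁻¹` with `m⁺ = max(m,0)`,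
`m⁻ = max(-m, 0)`. [folklore] -/
theorem prod_zpow_eq_div {k : ℕ} (m : Fin k → ℤ) {y : Fin k → R} (hy : ∀ i, y i ≠ 0) :
    ∏ i, y i ^ m i = (∏ i, y i ^ (m i).toNat) * (∏ i, y i ^ (-m i).toNat)⁻¹ := by
  rw [eq_mul_inv_iff_mul_eq₀ (Finset.prod_ne_zero_iff.2 fun i _ => pow_ne_zero _ (hy i)),
    ← Finset.prod_mul_distrib]
  refine Finset.prod_congr rfl fun i _ => ?_
  rw [← zpow_natCast, ← zpow_natCast, ← zpow_add₀ (hy i)]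
  congr 1
  have := Int.toNat_sub_toNat_neg (m i)
  omega

/-- **Binomial form of a Laurent monomial equation**: for `y` in the torus and any `u, v`,
`(∏ yᵢ^{mᵢ}) u = v ↔ (∏ yᵢ^{mᵢ⁺}) u = v ∏ yᵢ^{mᵢ⁻}`. [folklore] -/
theorem prod_zpow_mul_eq_iff {k : ℕ} (m : Fin k → ℤ) {y : Fin k → R} (hy : ∀ i, y i ≠ 0)
    (u v : R) :
    (∏ i, y i ^ m i) * u = v ↔ (∏ i, y i ^ (m i).toNat) * u = v * ∏ i, y i ^ (-m i).toNat := by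
  have hne : (∏ i, y i ^ (-m i).toNat) ≠ 0 :=
    Finset.prod_ne_zero_iff.2 fun i _ => pow_ne_zero _ (hy i)
  rw [prod_zpow_eq_div m hy]
  constructor
  · intro h
    rw [← h]; field_simp
  · intro h
    field_simp
    linear_combination h

end Binomial

/-- The binomial polynomial `∏ Yᵢ^{mᵢ⁺} · g − C c · h · ∏ Yᵢ^{mᵢ⁻}` attached to a Laurent
monomial equation `∏ yᵢ^{mᵢ} · g = c · h`. [folklore] -/
def binomPoly {k : ℕ} (m : Fin k → ℤ) (c : F) (g h : MvPolynomial (Fin k ⊕ Fin k) F) :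
    MvPolynomial (Fin k ⊕ Fin k) F :=
  (∏ i, X (Sum.inr i) ^ (m i).toNat) * g - C c * h * ∏ i, X (Sum.inr i) ^ (-m i).toNat

omit [IsAlgClosed F] in
/-- Evaluation of the binomial polynomial at a torus point: `binomPoly m c g h` vanishes at `z`
iff `(∏ z_yᵢ^{mᵢ}) g(z) = c h(z)`. [folklore] -/
theorem aeval_binomPoly_eq_zero_iff {k : ℕ} (m : Fin k → ℤ) (c : F)
    (g h : MvPolynomial (Fin k ⊕ Fin k) F) {R : Type*} [Field R] [Algebra F R]
    {z : Fin k ⊕ Fin k → R} (hz : z ∈ torusLocus R k) :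
    aeval z (binomPoly m c g h) = 0 ↔
      (∏ i, z (Sum.inr i) ^ m i) * aeval z g = algebraMap F R c * aeval z h := by
  rw [prod_zpow_mul_eq_iff m hz]
  simp only [binomPoly, map_sub, map_mul, map_prod, map_pow, aeval_X, aeval_C, sub_eq_zero]

omit [IsAlgClosed F] in
/-- Special case `g = h = 1`: `binomPoly m c 1 1` vanishes at a torus point `z` iff
`∏ z_yᵢ^{mᵢ} = c`. [folklore] -/
theorem aeval_binomPoly_one_eq_zero_iff {k : ℕ} (m : Fin k → ℤ) (c : F)
    {R : Type*} [Field R] [Algebra F R] {z : Fin k ⊕ Fin k → R} (hz : z ∈ torusLocus R k) :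
    aeval z (binomPoly m c 1 1) = 0 ↔ (∏ i, z (Sum.inr i) ^ m i) = algebraMap F R c := by
  rw [aeval_binomPoly_eq_zero_iff m c 1 1 hz]
  simp only [map_one, mul_one]

/-- **`Z(Q) ∩ G^{n+1}` is multiplicatively free** if `V` is, provided `f` has a zero on
`V`: a multiplicative relation `∏ yᵢ^{mᵢ} = c` on `Z(Q) ∩ G^{n+1}` gives, at `ξ⁺`,
`∏ⱼ ξ_yⱼ^{mⱼ} · f(ξ)^{-e} = c` (`e` the last exponent); if `e = 0` the relation descends to `V`,
otherwise `f` is a monomial up to the constant `c ≠ 0` on `V`, contradicting `f(z₀) = 0`.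
[cite: BaysKirby2018ANT, Def. 10.3 (remark)] -/
theorem isMulFree_zeroLocus_rabIdeal (hne : (zeroLocus F P ∩ torusLocus F n).Nonempty)
    (hf : f ∉ P) (hmul : IsMulFree F n (zeroLocus F P ∩ torusLocus F n))
    (hroot : ∃ z₀ ∈ zeroLocus F P ∩ torusLocus F n, aeval z₀ f = 0) :
    IsMulFree F (n + 1) (zeroLocus F (rabIdeal P f) ∩ torusLocus F (n + 1)) := by
  classical
  rintro m hm ⟨c, hc⟩
  set m' : Fin n → ℤ := fun j => m (Fin.castSucc j) with hm'
  set e : ℤ := m (Fin.last n) with he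
  -- `binomPoly m c 1 1 ∈ Q`
  have hQ : binomPoly m c 1 1 ∈ rabIdeal P f := by
    rw [← vanishingIdeal_zeroLocus_inter_torusLocus (rabIdeal P f)
      (nonempty_zeroLocus_rabIdeal P f hne hf), mem_vanishingIdeal_iff]
    intro z hz
    rw [aeval_binomPoly_one_eq_zero_iff m c hz.2, Algebra.algebraMap_self, RingHom.id_apply]
    exact hc z hz
  -- evaluate at `ξ⁺`
  have hξT := rabPt_mem_torusLocus P f hne hf
  have hxT := xiV_mem_torusLocus P hne
  have hstar : (∏ i, rabPt P f (Sum.inr i) ^ m i) = algebraMap F (RabField P) c := by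
    have := (isGenericPt_rabPt P f _).2 hQ
    rwa [aeval_binomPoly_one_eq_zero_iff m c hξT] at this
  rw [Fin.prod_univ_castSucc] at hstar
  simp only [rabPt_inr_castSucc, rabPt_inr_last] at hstar
  replace hstar : (∏ j, xiV P (Sum.inr j) ^ m' j) * ((aeval (xiV P) f)⁻¹) ^ e =
      algebraMap F (RabField P) c := hstar
  have hfξ : aeval (xiV P) f ≠ 0 := aeval_xiV_ne_zero P f hf
  have hc0 : c ≠ 0 := by
    intro h0
    rw [h0, RingHom.map_zero] at hstar
    refine (mul_ne_zero (Finset.prod_ne_zero_iff.2 fun j _ => zpow_ne_zero _ (hxT j))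
      (zpow_ne_zero _ (inv_ne_zero hfξ))) hstar
  obtain ⟨z₀, hz₀, hfz₀⟩ := hroot
  rcases lt_trichotomy e 0 with hlt | heq | hgt
  · -- `e < 0`: `f^{|e|} ∏ ξ_y^{m'} = c`, so `binomPoly m' c (f^{|e|}) 1 ∈ P`; at `z₀` this is absurd
    set k : ℕ := (-e).toNat with hk
    have hke : ((k : ℕ) : ℤ) = -e := by rw [hk]; omega
    have h1 : (∏ j, xiV P (Sum.inr j) ^ m' j) * aeval (xiV P) (f ^ k) =
        algebraMap F (RabField P) c * aeval (xiV P) (1 : MvPolynomial (Fin n ⊕ Fin n) F) := by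
      rw [map_one, mul_one, map_pow, ← hstar, inv_zpow', ← zpow_natCast, hke]
    have hP : binomPoly m' c (f ^ k) 1 ∈ P :=
      (isGenericPt_xiV P _).1 ((aeval_binomPoly_eq_zero_iff m' c (f ^ k) 1 hxT).2 h1)
    have := (mem_zeroLocus_iff.1 hz₀.1) _ hP
    rw [aeval_binomPoly_eq_zero_iff m' c (f ^ k) 1 hz₀.2, map_pow, hfz₀, map_one, mul_one,
      Algebra.algebraMap_self, RingHom.id_apply] at this
    have hk0 : k ≠ 0 := by omega
    rw [zero_pow hk0, mul_zero] at this
    exact hc0 this.symm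
  · -- `e = 0`: the relation descends to `V`
    have hm'0 : m' ≠ 0 := by
      intro h
      apply hm
      funext i
      refine Fin.lastCases ?_ (fun j => ?_) i
      · exact heq
      · exact congrFun h j
    refine hmul m' hm'0 ⟨c, fun z hz => ?_⟩
    have h1 : (∏ j, xiV P (Sum.inr j) ^ m' j) = algebraMap F (RabField P) c := by
      rw [← hstar, heq, zpow_zero, mul_one]
    have hP : binomPoly m' c 1 1 ∈ P :=
      (isGenericPt_xiV P _).1 ((aeval_binomPoly_one_eq_zero_iff m' c hxT).2 h1)
    have := (mem_zeroLocus_iff.1 hz.1) _ hP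
    rwa [aeval_binomPoly_one_eq_zero_iff m' c hz.2, Algebra.algebraMap_self,
      RingHom.id_apply] at this
  · -- `e > 0`: `∏ ξ_y^{m'} = c f^e`, so `binomPoly m' c 1 (f^e) ∈ P`; at `z₀` this is absurd
    set k : ℕ := e.toNat with hk
    have hke : ((k : ℕ) : ℤ) = e := by rw [hk]; omega
    have h1 : (∏ j, xiV P (Sum.inr j) ^ m' j) * aeval (xiV P) (1 : MvPolynomial (Fin n ⊕ Fin n) F) =
        algebraMap F (RabField P) c * aeval (xiV P) (f ^ k) := by
      rw [map_one, mul_one, map_pow, ← hstar, inv_zpow', mul_assoc, ← zpow_natCast, hke,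
        ← zpow_add₀ hfξ, neg_add_cancel, zpow_zero, mul_one]
    have hP : binomPoly m' c 1 (f ^ k) ∈ P :=
      (isGenericPt_xiV P _).1 ((aeval_binomPoly_eq_zero_iff m' c 1 (f ^ k) hxT).2 h1)
    have := (mem_zeroLocus_iff.1 hz₀.1) _ hP
    rw [aeval_binomPoly_eq_zero_iff m' c 1 (f ^ k) hz₀.2, map_pow, hfz₀, map_one, mul_one] at this
    have hk0 : k ≠ 0 := by omega
    rw [zero_pow hk0, mul_zero] at this
    exact (Finset.prod_ne_zero_iff.2 fun j _ => zpow_ne_zero _ (hz₀.2 j)) this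

end Rabinowitsch

/-! ### Linear algebra: ranks of integer matrices under row operations -/

section LinAlg

open Module Submodule

/-- `map` commutes with `submatrix` (used to pass between an integer matrix and its rational
version). [folklore] -/
theorem map_submatrix_intCast {ι κ ι' κ' : Type*} (M : Matrix ι κ ℤ) (r : ι' → ι) (c : κ' → κ) :
    (M.submatrix r c).map (Int.cast : ℤ → ℚ) = (M.map (Int.cast : ℤ → ℚ)).submatrix r c := rfl

variable {ι κ : Type*} [Fintype ι] [Fintype κ]

/-- Two rational matrices whose rows span the same subspace have the same rank. [folklore] -/
theorem rank_eq_of_rows_mem_span {ι' : Type*} [Fintype ι'] (A : Matrix ι κ ℚ) (B : Matrix ι' κ ℚ)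
    (hAB : ∀ i, A i ∈ span ℚ (Set.range B)) (hBA : ∀ i, B i ∈ span ℚ (Set.range A)) :
    A.rank = B.rank := by
  rw [Matrix.rank_eq_finrank_span_row, Matrix.rank_eq_finrank_span_row]
  have : span ℚ (Set.range A.row) = span ℚ (Set.range B.row) :=
    le_antisymm (span_le.2 (by rintro _ ⟨i, rfl⟩; exact hAB i))
      (span_le.2 (by rintro _ ⟨i, rfl⟩; exact hBA i))
  rw [this]

/-- Deleting a row which is a linear combination of the other rows does not change the rank:
for `n + 1` row vectors in `ℚⁿ` some row is in the span of the others (`n + 1 > dim ℚⁿ`).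
[folklore] -/
theorem exists_rank_submatrix_succAbove_eq {m : ℕ} (A : Matrix (Fin (m + 1)) (Fin m) ℚ) :
    ∃ i₀ : Fin (m + 1), (A.submatrix (Fin.succAbove i₀) id).rank = A.rank := by
  have hdep : ¬ LinearIndependent ℚ A.row := by
    intro h
    have := h.fintype_card_le_finrank
    rw [Module.finrank_fintype_fun_eq_card (R := ℚ), Fintype.card_fin, Fintype.card_fin] at this
    omega
  rw [linearIndependent_iff_notMem_span] at hdep
  simp only [not_forall, not_not] at hdep
  obtain ⟨i₀, hi₀⟩ := hdep
  refine ⟨i₀, rank_eq_of_rows_mem_span _ _ (fun k => subset_span ⟨Fin.succAbove i₀ k, rfl⟩) ?_⟩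
  intro i
  by_cases hi : i = i₀
  · subst hi
    refine span_mono ?_ hi₀
    rintro _ ⟨j, hj, rfl⟩
    have hj' : j ≠ i := by simpa using hj.2
    obtain ⟨k, rfl⟩ := Fin.exists_succAbove_eq hj'
    exact ⟨k, rfl⟩
  · obtain ⟨k, rfl⟩ := Fin.exists_succAbove_eq hi
    exact subset_span ⟨k, rfl⟩

/-- Deleting a row decreases the rank by at most one. [folklore] -/
theorem rank_le_rank_submatrix_succAbove_add_one {m : ℕ} (B : Matrix (Fin (m + 1)) κ ℚ)
    (i₀ : Fin (m + 1)) : B.rank ≤ (B.submatrix (Fin.succAbove i₀) id).rank + 1 := by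
  rw [Matrix.rank_eq_finrank_span_row, Matrix.rank_eq_finrank_span_row]
  have hle : span ℚ (Set.range B.row) ≤
      span ℚ {B i₀} ⊔ span ℚ (Set.range (B.submatrix (Fin.succAbove i₀) id).row) := by
    refine span_le.2 ?_
    rintro _ ⟨i, rfl⟩
    by_cases hi : i = i₀
    · subst hi
      exact mem_sup_left (subset_span rfl)
    · obtain ⟨k, rfl⟩ := Fin.exists_succAbove_eq hi
      exact mem_sup_right (subset_span ⟨k, rfl⟩)
  refine (Submodule.finrank_mono hle).trans ?_
  refine (Submodule.finrank_add_le_finrank_add_finrank _ _).trans ?_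
  rw [add_comm]
  refine add_le_add le_rfl ?_
  have := finrank_span_le_card (R := ℚ) ({B i₀} : Set (κ → ℚ))
  simpa using this

omit [Fintype ι] in
/-- Deleting a zero column does not change the rank. [folklore] -/
theorem rank_submatrix_castSucc_of_last_eq_zero {m : ℕ} (N : Matrix ι (Fin (m + 1)) ℚ)
    (h : ∀ i, N i (Fin.last m) = 0) : (N.submatrix id Fin.castSucc).rank = N.rank := by
  rw [Matrix.rank_eq_finrank_span_cols, Matrix.rank_eq_finrank_span_cols]
  have hspan : span ℚ (Set.range (N.submatrix id Fin.castSucc).col) = span ℚ (Set.range N.col) := by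
    refine le_antisymm (span_mono ?_) (span_le.2 ?_)
    · rintro _ ⟨j, rfl⟩
      exact ⟨Fin.castSucc j, rfl⟩
    · rintro _ ⟨j, rfl⟩
      refine Fin.lastCases ?_ (fun k => ?_) j
      · have : N.col (Fin.last m) = 0 := funext fun i => h i
        rw [this]
        exact zero_mem _
      · exact subset_span ⟨k, rfl⟩
  rw [hspan]

end LinAlg

/-! ### Transcendence degree of generated subfields -/

section FieldTrdeg

variable {F : Type u} [Field F] {E : Type u} [Field E] [Algebra F E]

open scoped IntermediateField.algebraAdjoinAdjoin in
/-- `trdeg_F F(S) = trdeg_F F[S]`: the subfield generated by `S` is the fraction field of the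
subalgebra generated by `S`. [folklore] -/
theorem trdeg_intermediateField_adjoin_eq (S : Set E) :
    Algebra.trdeg F (IntermediateField.adjoin F S) = Algebra.trdeg F (Algebra.adjoin F S) := by
  haveI : FaithfulSMul F (Algebra.adjoin F S) :=
    (faithfulSMul_iff_algebraMap_injective F _).2 (algebraMap F (Algebra.adjoin F S)).injective
  obtain ⟨s, hs⟩ := exists_isTranscendenceBasis F (Algebra.adjoin F S)
  have hs' := hs.algebraMap_comp (A := IntermediateField.adjoin F S)
  rw [← hs.cardinalMk_eq_trdeg, ← hs'.cardinalMk_eq_trdeg]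

/-- Monotonicity: if `S ⊆ F(T)` then `trdeg_F F(S) ≤ trdeg_F F(T)`. [folklore] -/
theorem trdeg_intermediateField_adjoin_mono {S T : Set E} (h : S ⊆ IntermediateField.adjoin F T) :
    Algebra.trdeg F (IntermediateField.adjoin F S) ≤
      Algebra.trdeg F (IntermediateField.adjoin F T) := by
  have hle : IntermediateField.adjoin F S ≤ IntermediateField.adjoin F T :=
    IntermediateField.adjoin_le_iff.2 h
  exact trdeg_le_of_injective (IntermediateField.inclusion hle)
    (IntermediateField.inclusion_injective hle)

/-- **Algebraic extensions do not change the transcendence degree**: if `K₁ ≤ K₂` are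
intermediate fields and every element of `K₂` is algebraic over `K₁` then
`trdeg_F K₂ ≤ trdeg_F K₁` (tower law `trdeg_F K₂ = trdeg_F K₁ + trdeg_{K₁} K₂`, Stacks 030H).
[folklore] -/
theorem trdeg_le_of_isAlgebraic {K₁ K₂ : IntermediateField F E} (hle : K₁ ≤ K₂)
    (halg : ∀ x : E, x ∈ K₂ → IsAlgebraic K₁ x) :
    Algebra.trdeg F K₂ ≤ Algebra.trdeg F K₁ := by
  letI : Algebra K₁ K₂ := (IntermediateField.inclusion hle).toRingHom.toAlgebra
  haveI : IsScalarTower F K₁ K₂ := IsScalarTower.of_algebraMap_eq fun _ => rfl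
  haveI : FaithfulSMul K₁ K₂ :=
    (faithfulSMul_iff_algebraMap_injective K₁ K₂).2 (IntermediateField.inclusion_injective hle)
  haveI : IsScalarTower K₁ K₂ E := IsScalarTower.of_algebraMap_eq fun _ => rfl
  haveI : Algebra.IsAlgebraic K₁ K₂ := by
    refine ⟨fun x => ?_⟩
    have hx : IsAlgebraic K₁ (x : E) := halg x x.2
    exact (isAlgebraic_algebraMap_iff (FaithfulSMul.algebraMap_injective K₂ E)).1 hx
  have h := trdeg_add_eq F K₁ (A := K₂)
  rw [trdeg_eq_zero (R := K₁) (A := K₂), add_zero] at h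
  exact le_of_eq h.symm

/-- **Adding a transcendental raises the transcendence degree**: if `x : Fin r → E` is
algebraically independent over `F` with values in an intermediate field `L`, and `t` is
transcendental over `L`, then `(x, t)` is algebraically independent over `F`. [folklore] -/
theorem algebraicIndependent_option_of_transcendental {L : IntermediateField F E} {r : ℕ}
    {x : Fin r → E} (hx : AlgebraicIndependent F x) (hxL : ∀ i, x i ∈ L) {t : E}
    (ht : Transcendental L t) :
    AlgebraicIndependent F fun o : Option (Fin r) => o.elim t x := by
  rw [hx.option_iff_transcendental]
  have hle : Algebra.adjoin F (Set.range x) ≤ L.toSubalgebra :=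
    Algebra.adjoin_le (by rintro _ ⟨i, rfl⟩; exact hxL i)
  exact Transcendental.of_tower_top_of_subalgebra_le hle ht

end FieldTrdeg

/-! ### Rotundity of `Z(Q)` -/

namespace Rabinowitsch

variable {F : Type u} [Field F]
variable {n : ℕ} (P : Ideal (MvPolynomial (Fin n ⊕ Fin n) F)) [hP : P.IsPrime]
  (f : MvPolynomial (Fin n ⊕ Fin n) F)

section Coordinates

/-- Linear forms in the additive coordinates of `ξ⁺`: `U(c, p) = ∑ⱼ cⱼ ξ_xⱼ + p T`. [folklore] -/
def uForm (c : Fin n → ℤ) (p : ℤ) : RabField P :=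
  (∑ j, ((c j : ℤ) : RabField P) * xiV P (Sum.inl j)) + ((p : ℤ) : RabField P) * tGen P

/-- Laurent monomials in the multiplicative coordinates of `ξ⁺`:
`W(c, p) = (∏ⱼ ξ_yⱼ^{cⱼ}) · (f(ξ)⁻¹)^p`. [folklore] -/
def wForm (c : Fin n → ℤ) (p : ℤ) : RabField P :=
  (∏ j, xiV P (Sum.inr j) ^ c j) * ((aeval (xiV P) f)⁻¹) ^ p

/-- A linear-combination identity in any commutative ring:
`a (∑ cⱼ xⱼ + p t) + e (∑ dⱼ xⱼ + q t) = ∑ (a cⱼ + e dⱼ) xⱼ + (a p + e q) t`. [folklore] -/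
theorem sum_lin_identity {R : Type*} [CommRing R] {m : ℕ} (x : Fin m → R) (t : R)
    (c d : Fin m → ℤ) (p q a e : ℤ) :
    ((a : ℤ) : R) * ((∑ j, ((c j : ℤ) : R) * x j) + ((p : ℤ) : R) * t) +
      ((e : ℤ) : R) * ((∑ j, ((d j : ℤ) : R) * x j) + ((q : ℤ) : R) * t) =
      (∑ j, (((a * c j + e * d j : ℤ) : ℤ) : R) * x j) + (((a * p + e * q : ℤ) : ℤ) : R) * t := by
  have h : ∀ j, (((a * c j + e * d j : ℤ) : ℤ) : R) * x j =
      ((a : ℤ) : R) * (((c j : ℤ) : R) * x j) + ((e : ℤ) : R) * (((d j : ℤ) : R) * x j) := fun j => by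
    rw [Int.cast_add, Int.cast_mul, Int.cast_mul]; ring
  rw [Finset.sum_congr rfl (fun j _ => h j), Finset.sum_add_distrib, ← Finset.mul_sum,
    ← Finset.mul_sum, Int.cast_add, Int.cast_mul, Int.cast_mul]
  ring

omit hP in
/-- `ℤ`-bilinearity of `U`: `a U(c, p) + e U(d, q) = U(a c + e d, a p + e q)`. [folklore] -/
theorem uForm_lin (c d : Fin n → ℤ) (p q a e : ℤ) :
    ((a : ℤ) : RabField P) * uForm P c p + ((e : ℤ) : RabField P) * uForm P d q =
      uForm P (fun j => a * c j + e * d j) (a * p + e * q) :=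
  sum_lin_identity (fun j => xiV P (Sum.inl j)) (tGen P) c d p q a e

/-- Multiplicativity of `W`: `W(c, p)^a W(d, q)^e = W(a c + e d, a p + e q)` (all coordinates
non-zero). [folklore] -/
theorem wForm_lin (hx : ∀ j, xiV P (Sum.inr j) ≠ 0) (hfξ : aeval (xiV P) f ≠ 0)
    (c d : Fin n → ℤ) (p q a e : ℤ) :
    wForm P f c p ^ a * wForm P f d q ^ e =
      wForm P f (fun j => a * c j + e * d j) (a * p + e * q) := by
  have hfi : (aeval (xiV P) f)⁻¹ ≠ 0 := inv_ne_zero hfξ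
  have e1 : ∀ j, xiV P (Sum.inr j) ^ (a * c j + e * d j) =
      (xiV P (Sum.inr j) ^ c j) ^ a * (xiV P (Sum.inr j) ^ d j) ^ e := fun j => by
    rw [← zpow_mul, ← zpow_mul, ← zpow_add₀ (hx j)]; congr 1; ring
  have e2 : ((aeval (xiV P)) f)⁻¹ ^ (a * p + e * q) =
      (((aeval (xiV P)) f)⁻¹ ^ p) ^ a * (((aeval (xiV P)) f)⁻¹ ^ q) ^ e := by
    rw [← zpow_mul, ← zpow_mul, ← zpow_add₀ hfi]; congr 1; ring
  simp only [wForm, mul_zpow, ← Finset.prod_zpow]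
  rw [Finset.prod_congr rfl (fun j _ => e1 j), e2, Finset.prod_mul_distrib]
  ring

/-- Additive coordinates of `[M] ξ⁺`: `([M] ξ⁺)_{x,i} = U(Mᵢ|_{<n}, M_{i,n})`. [folklore] -/
theorem matrixAct_rabPt_inl (M : Matrix (Fin (n + 1)) (Fin (n + 1)) ℤ) (i : Fin (n + 1)) :
    matrixAct M (rabPt P f) (Sum.inl i) =
      uForm P (fun j => M i (Fin.castSucc j)) (M i (Fin.last n)) := by
  simp only [matrixAct_inl, Fin.sum_univ_castSucc, rabPt_inl_castSucc, rabPt_inl_last, uForm]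

/-- Multiplicative coordinates of `[M] ξ⁺`: `([M] ξ⁺)_{y,i} = W(Mᵢ|_{<n}, M_{i,n})`. [folklore] -/
theorem matrixAct_rabPt_inr (M : Matrix (Fin (n + 1)) (Fin (n + 1)) ℤ) (i : Fin (n + 1)) :
    matrixAct M (rabPt P f) (Sum.inr i) =
      wForm P f (fun j => M i (Fin.castSucc j)) (M i (Fin.last n)) := by
  simp only [matrixAct_inr, Fin.prod_univ_castSucc, rabPt_inr_castSucc, rabPt_inr_last, wForm]

/-- Additive coordinates of `[N] ξ`: `([N] ξ)_{x,k} = U(N_k, 0)`. [folklore] -/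
theorem matrixAct_xiV_inl (N : Matrix (Fin n) (Fin n) ℤ) (k : Fin n) :
    matrixAct N (xiV P) (Sum.inl k) = uForm P (fun j => N k j) 0 := by
  simp [matrixAct_inl, uForm]

/-- Multiplicative coordinates of `[N] ξ`: `([N] ξ)_{y,k} = W(N_k, 0)`. [folklore] -/
theorem matrixAct_xiV_inr (N : Matrix (Fin n) (Fin n) ℤ) (k : Fin n) :
    matrixAct N (xiV P) (Sum.inr k) = wForm P f (fun j => N k j) 0 := by
  simp [matrixAct_inr, wForm]

end Coordinates

variable [IsAlgClosed F]

/-- The field `L = F(V) ⊆ E` as an intermediate field (image of `F(V) → E`). [folklore] -/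
def fieldL : IntermediateField F (RabField P) := (toRab P).fieldRange

omit [IsAlgClosed F] in
/-- `ξ`-coordinates lie in `L`. [folklore] -/
theorem xiV_mem_fieldL (j : Fin n ⊕ Fin n) : xiV P j ∈ fieldL P :=
  ⟨genericPt P j, rfl⟩

omit [IsAlgClosed F] in
/-- `T` is transcendental over the intermediate field `L`. [folklore] -/
theorem transcendental_fieldL_tGen : Transcendental (fieldL P) (tGen P) := by
  let g : zeroLocusFunctionField P →+* fieldL P :=
    (toRab P).toRingHom.codRestrict (fieldL P).toSubalgebra.toSubring.toSubsemiring
      fun k => ⟨k, rfl⟩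
  have hg : Function.Surjective g := by
    rintro ⟨x, k, rfl⟩
    exact ⟨k, rfl⟩
  have h := Transcendental.ringHom_of_comp_eq (R := zeroLocusFunctionField P) (S := fieldL P)
    (A := RabField P) (B := RabField P) g (RingHom.id (RabField P)) (transcendental_tGen P) hg
    Function.injective_id (by ext k; rfl)
  exact h

omit [IsAlgClosed F] in
/-- Coordinates of `[N] ξ` lie in `L`. [folklore] -/
theorem matrixAct_xiV_mem_fieldL (N : Matrix (Fin n) (Fin n) ℤ) (j : Fin n ⊕ Fin n) :
    matrixAct N (xiV P) j ∈ fieldL P := by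
  cases j with
  | inl k =>
    rw [matrixAct_inl]
    exact sum_mem fun j _ => mul_mem (intCast_mem _ _) (xiV_mem_fieldL P _)
  | inr k =>
    rw [matrixAct_inr]
    exact prod_mem fun j _ => zpow_mem (xiV_mem_fieldL P _) _

/-- **Rank bound from the rotundity of `V`**: for `N ∈ Mₙ(ℤ)`, the rank of `N` is at most the
transcendence degree of `F[[N] ξ]`, which is finite; packaged as a transcendence basis of
`F[[N] ξ] ⊆ E` indexed by `Fin k` with `rk N ≤ k`. [cite: BaysKirby2018ANT, Prop. 7.3 (proof)] -/
theorem exists_algIndep_of_isRotund (hne : (zeroLocus F P ∩ torusLocus F n).Nonempty)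
    (hrot : IsRotund F n (zeroLocus F P ∩ torusLocus F n)) (N : Matrix (Fin n) (Fin n) ℤ) :
    ∃ (k : ℕ) (x : Fin k → RabField P), (N.map (Int.cast : ℤ → ℚ)).rank ≤ k ∧
      AlgebraicIndependent F x ∧
      ∀ i, x i ∈ Algebra.adjoin F (Set.range (matrixAct N (xiV P))) := by
  classical
  set φ := (aeval (matrixAct N (xiV P)) : MvPolynomial (Fin n ⊕ Fin n) F →ₐ[F] RabField P)
    with hφ
  haveI : Algebra.FiniteType F φ.range :=
    Algebra.FiniteType.of_surjective φ.rangeRestrict (AlgHom.rangeRestrict_surjective φ)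
  haveI : FaithfulSMul F φ.range :=
    (faithfulSMul_iff_algebraMap_injective F φ.range).2 (algebraMap F φ.range).injective
  set k : ℕ := Cardinal.toNat (Algebra.trdeg F φ.range) with hk
  have htr : Algebra.trdeg F φ.range = k := Literature.RingTheory.KrullDimension.trdeg_eq_toNat F φ.range
  -- the rotundity of `V`, read through the toolkit
  have hrank : (N.map (Int.cast : ℤ → ℚ)).rank ≤ k := by
    have h := hrot N
    rw [zariskiDim_image_matrixAct_eq P (isGenericPt_xiV P) hne N] at h
    exact_mod_cast h
  -- a transcendence basis of `range φ`, indexed by `Fin k`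
  obtain ⟨s, hs⟩ := exists_isTranscendenceBasis F φ.range
  have hcard : Cardinal.mk s = k := by rw [hs.cardinalMk_eq_trdeg, htr]
  obtain ⟨e⟩ := Cardinal.mk_eq_nat_iff.1 hcard
  refine ⟨k, fun i => ((e.symm i : s) : φ.range), hrank, ?_, fun i => ?_⟩
  · have h1 : AlgebraicIndependent F (fun i => (e.symm i : s) : Fin k → φ.range) :=
      hs.1.comp _ e.symm.injective
    exact h1.map' (f := φ.range.val) Subtype.val_injective
  · rw [Algebra.adjoin_range_eq_range_aeval]
    exact ((e.symm i : s) : φ.range).2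

/-- **`Z(Q) ∩ G^{n+1}` is rotund** if `V` is. For `M ∈ M_{n+1}(ℤ)`, `dim [M](Z(Q) ∩ G^{n+1})` is
the transcendence degree of `F[[M] ξ⁺]`. If the last column of `M` vanishes, the coordinates of
`[M] ξ⁺` are those of `[N] ξ` for the `n × n` matrix `N` obtained by deleting the last column and
a row depending on the others, `rk N = rk M`, and rotundity of `V` gives `rk N` algebraically
independent elements. Otherwise pick a row `i₀` with `M_{i₀,n} ≠ 0` and clear the last column of
the other rows by integer row operations (rank unchanged); the cleared rows act on `ξ` as an
`n × n` matrix `N` with `rk M ≤ rk N + 1`, whose coordinates lie in `F(V)`, and row `i₀`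
contributes `([M] ξ⁺)_{x,i₀} ∈ F(V) + M_{i₀,n} T`, transcendental over `F(V)`.
[cite: BaysKirby2018ANT, Def. 10.3 (remark), Def. 7.1] -/
theorem isRotund_zeroLocus_rabIdeal [CharZero F] (hne : (zeroLocus F P ∩ torusLocus F n).Nonempty)
    (hf : f ∉ P) (hrot : IsRotund F n (zeroLocus F P ∩ torusLocus F n)) :
    IsRotund F (n + 1) (zeroLocus F (rabIdeal P f) ∩ torusLocus F (n + 1)) := by
  classical
  intro M
  have hne' := nonempty_zeroLocus_rabIdeal P f hne hf
  -- the dimension of the image as a transcendence degree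
  set ψ := (aeval (matrixAct M (rabPt P f)) :
    MvPolynomial (Fin (n + 1) ⊕ Fin (n + 1)) F →ₐ[F] RabField P) with hψ
  rw [zariskiDim_image_matrixAct_eq (rabIdeal P f) (isGenericPt_rabPt P f) hne' M]
  haveI : Algebra.FiniteType F ψ.range :=
    Algebra.FiniteType.of_surjective ψ.rangeRestrict (AlgHom.rangeRestrict_surjective ψ)
  set kM : ℕ := Cardinal.toNat (Algebra.trdeg F ψ.range) with hkM
  have htrM : Algebra.trdeg F ψ.range = kM := Literature.RingTheory.KrullDimension.trdeg_eq_toNat F ψ.range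
  -- it suffices to find `rk M` algebraically independent elements of `F(range ψ) = K_M`
  set KM : IntermediateField F (RabField P) :=
    IntermediateField.adjoin F (Set.range (matrixAct M (rabPt P f))) with hKM
  have htrKM : Algebra.trdeg F KM = kM := by
    rw [hKM, trdeg_intermediateField_adjoin_eq, Algebra.adjoin_range_eq_range_aeval, ← hψ, htrM]
  suffices key : ∃ (r : ℕ) (y : Fin r → RabField P), (M.map (Int.cast : ℤ → ℚ)).rank ≤ r ∧
      AlgebraicIndependent F y ∧ ∀ i, y i ∈ KM by
    obtain ⟨r, y, hr, hy, hyK⟩ := key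
    let y' : Fin r → KM := fun i => ⟨y i, hyK i⟩
    have hy' : AlgebraicIndependent F y' := AlgebraicIndependent.of_comp KM.val hy
    have h1 := hy'.lift_cardinalMk_le_trdeg
    rw [Cardinal.mk_fin, Cardinal.lift_natCast, htrKM, Cardinal.lift_natCast] at h1
    have h2 : r ≤ kM := by exact_mod_cast h1
    exact_mod_cast hr.trans h2
  have hxT := xiV_mem_torusLocus P hne
  have hfξ : aeval (xiV P) f ≠ 0 := aeval_xiV_ne_zero P f hf
  -- generators of `K_M`
  have hu : ∀ i, uForm P (fun j => M i (Fin.castSucc j)) (M i (Fin.last n)) ∈ KM := fun i => by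
    rw [← matrixAct_rabPt_inl]
    exact IntermediateField.subset_adjoin F _ ⟨Sum.inl i, rfl⟩
  have hw : ∀ i, wForm P f (fun j => M i (Fin.castSucc j)) (M i (Fin.last n)) ∈ KM := fun i => by
    rw [← matrixAct_rabPt_inr]
    exact IntermediateField.subset_adjoin F _ ⟨Sum.inr i, rfl⟩
  set MQ := M.map (Int.cast : ℤ → ℚ) with hMQ
  by_cases hb : ∀ i, M i (Fin.last n) = 0
  · -- Case A: last column zero
    set A := MQ.submatrix id Fin.castSucc with hA
    have hrkA : A.rank = MQ.rank :=
      rank_submatrix_castSucc_of_last_eq_zero MQ fun i => by simp [hMQ, hb i]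
    obtain ⟨i₀, hi₀⟩ := exists_rank_submatrix_succAbove_eq A
    set N : Matrix (Fin n) (Fin n) ℤ := M.submatrix (Fin.succAbove i₀) Fin.castSucc with hN
    have hNQ : N.map (Int.cast : ℤ → ℚ) = A.submatrix (Fin.succAbove i₀) id := rfl
    obtain ⟨k, x, hk, hx, hxmem⟩ := exists_algIndep_of_isRotund P hne hrot N
    refine ⟨k, x, ?_, hx, fun i => ?_⟩
    · rw [← hrkA, ← hi₀, ← hNQ]; exact hk
    · -- `F[[N] ξ] ⊆ K_M` since the coordinates of `[N] ξ` are coordinates of `[M] ξ⁺`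
      have hsub : Set.range (matrixAct N (xiV P)) ⊆ KM := by
        rintro _ ⟨j, rfl⟩
        cases j with
        | inl kk =>
          rw [matrixAct_xiV_inl]
          have := hu (Fin.succAbove i₀ kk)
          rwa [hb] at this
        | inr kk =>
          rw [matrixAct_xiV_inr P f]
          have := hw (Fin.succAbove i₀ kk)
          rwa [hb] at this
      exact (Algebra.adjoin_le (S := KM.toSubalgebra) hsub) (hxmem i)
  · -- Case B: some `M i₀ n ≠ 0`; row-reduce
    simp only [not_forall] at hb
    obtain ⟨i₀, hi₀⟩ := hb
    set b : Fin (n + 1) → ℤ := fun i => M i (Fin.last n) with hbdef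
    set M' : Matrix (Fin (n + 1)) (Fin (n + 1)) ℤ :=
      fun i j => if i = i₀ then M i₀ j else b i₀ * M i j - b i * M i₀ j with hM'
    have hM'i₀ : ∀ j, M' i₀ j = M i₀ j := fun j => by simp [hM']
    have hM'ne : ∀ i, i ≠ i₀ → ∀ j, M' i j = b i₀ * M i j - b i * M i₀ j := fun i hi j => by
      simp [hM', hi]
    have hM'last : ∀ i, i ≠ i₀ → M' i (Fin.last n) = 0 := fun i hi => by
      rw [hM'ne i hi]; simp only [hbdef]; ring
    set M'Q := M'.map (Int.cast : ℤ → ℚ) with hM'Q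
    -- (B1) same rank
    have hbQ : ((b i₀ : ℤ) : ℚ) ≠ 0 := Int.cast_ne_zero.2 hi₀
    have hrk : M'Q.rank = MQ.rank := by
      refine rank_eq_of_rows_mem_span M'Q MQ (fun i => ?_) (fun i => ?_)
      · by_cases hi : i = i₀
        · subst hi
          have : M'Q i = MQ i := funext fun j => by simp [hM'Q, hMQ, hM'i₀]
          rw [this]; exact Submodule.subset_span ⟨i, rfl⟩
        · have : M'Q i = ((b i₀ : ℤ) : ℚ) • MQ i - ((b i : ℤ) : ℚ) • MQ i₀ := funext fun j => by
            simp [hM'Q, hMQ, hM'ne i hi]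
          rw [this]
          exact Submodule.sub_mem _ (Submodule.smul_mem _ _ (Submodule.subset_span ⟨i, rfl⟩))
            (Submodule.smul_mem _ _ (Submodule.subset_span ⟨i₀, rfl⟩))
      · by_cases hi : i = i₀
        · subst hi
          have : MQ i = M'Q i := funext fun j => by simp [hM'Q, hMQ, hM'i₀]
          rw [this]; exact Submodule.subset_span ⟨i, rfl⟩
        · have : MQ i = ((b i₀ : ℤ) : ℚ)⁻¹ • (M'Q i + ((b i : ℤ) : ℚ) • M'Q i₀) := funext fun j => by
            simp only [hM'Q, hMQ, Matrix.map_apply, hM'ne i hi, hM'i₀, Pi.smul_apply, Pi.add_apply,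
              smul_eq_mul, Int.cast_sub, Int.cast_mul]
            field_simp
            ring
          rw [this]
          exact Submodule.smul_mem _ _ (Submodule.add_mem _ (Submodule.subset_span ⟨i, rfl⟩)
            (Submodule.smul_mem _ _ (Submodule.subset_span ⟨i₀, rfl⟩)))
    -- (B3) `rk M' ≤ rk N + 1`
    set N : Matrix (Fin n) (Fin n) ℤ := M'.submatrix (Fin.succAbove i₀) Fin.castSucc with hN
    have hrkN : MQ.rank ≤ (N.map (Int.cast : ℤ → ℚ)).rank + 1 := by
      rw [← hrk]
      refine (rank_le_rank_submatrix_succAbove_add_one M'Q i₀).trans ?_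
      have hz : ∀ i, (M'Q.submatrix (Fin.succAbove i₀) id) i (Fin.last n) = 0 := fun i => by
        simp [hM'Q, hM'last _ (Fin.succAbove_ne i₀ i)]
      rw [← rank_submatrix_castSucc_of_last_eq_zero _ hz]
      rfl
    -- (B4) the algebraically independent family: a transcendence basis of `F[[N] ξ]` and `u'_{i₀}`
    obtain ⟨k, x, hk, hx, hxmem⟩ := exists_algIndep_of_isRotund P hne hrot N
    set t : RabField P := uForm P (fun j => M i₀ (Fin.castSucc j)) (M i₀ (Fin.last n)) with ht
    have htL : Transcendental (fieldL P) t := by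
      intro halg
      apply transcendental_fieldL_tGen P
      -- `T = (t - ∑ⱼ M_{i₀ j} ξ_xⱼ) / b_{i₀}`
      have hsum : (∑ j, ((M i₀ (Fin.castSucc j) : ℤ) : RabField P) * xiV P (Sum.inl j)) ∈ fieldL P :=
        sum_mem fun j _ => mul_mem (intCast_mem _ _) (xiV_mem_fieldL P _)
      haveI : CharZero (RabField P) :=
        charZero_of_injective_algebraMap (algebraMap F (RabField P)).injective
      have hbE : ((b i₀ : ℤ) : RabField P) ≠ 0 := Int.cast_ne_zero.2 hi₀
      have hT : tGen P = (t - ∑ j, ((M i₀ (Fin.castSucc j) : ℤ) : RabField P) * xiV P (Sum.inl j)) *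
          (((b i₀ : ℤ) : RabField P))⁻¹ := by
        rw [ht, uForm, add_sub_cancel_left, mul_comm (((b i₀ : ℤ) : RabField P)) (tGen P),
          mul_inv_cancel_right₀ hbE]
      rw [hT]
      have alg_of_mem : ∀ z : RabField P, z ∈ fieldL P → IsAlgebraic (fieldL P) z :=
        fun z hz => isAlgebraic_algebraMap (R := fieldL P) (A := RabField P) (⟨z, hz⟩ : fieldL P)
      exact IsAlgebraic.mul (IsAlgebraic.sub halg (alg_of_mem _ hsum))
        (IsAlgebraic.inv (alg_of_mem _ (intCast_mem _ _)))
    have hxL : ∀ i, x i ∈ fieldL P := fun i =>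
      (Algebra.adjoin_le (S := (fieldL P).toSubalgebra)
        (by rintro _ ⟨j, rfl⟩; exact matrixAct_xiV_mem_fieldL P N j)) (hxmem i)
    have hfam : AlgebraicIndependent F fun o : Option (Fin k) => o.elim t x :=
      algebraicIndependent_option_of_transcendental (L := fieldL P) (t := t) hx hxL htL
    -- reindex `Option (Fin k) ≃ Fin (k + 1)`
    refine ⟨k + 1, (fun o : Option (Fin k) => o.elim t x) ∘ (finSuccEquiv k), ?_, ?_, ?_⟩
    · exact hrkN.trans (Nat.add_le_add_right hk 1)
    · exact hfam.comp _ (finSuccEquiv k).injective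
    · -- membership in `K_M`
      have hN_coords : Set.range (matrixAct N (xiV P)) ⊆ KM := by
        rintro _ ⟨j, rfl⟩
        cases j with
        | inl kk =>
          rw [matrixAct_xiV_inl]
          set i := Fin.succAbove i₀ kk with hi
          have hii : i ≠ i₀ := Fin.succAbove_ne i₀ kk
          have key : (((b i₀ : ℤ) : RabField P) * uForm P (fun j => M i (Fin.castSucc j)) (b i) +
              ((-b i : ℤ) : RabField P) * uForm P (fun j => M i₀ (Fin.castSucc j)) (b i₀) :
                RabField P) =
              uForm P (fun j => b i₀ * M i (Fin.castSucc j) + -b i * M i₀ (Fin.castSucc j))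
                (b i₀ * b i + -b i * b i₀) :=
            uForm_lin P _ _ _ _ _ _
          have heq : uForm P (fun j => N kk j) 0 =
              uForm P (fun j => b i₀ * M i (Fin.castSucc j) + -b i * M i₀ (Fin.castSucc j))
                (b i₀ * b i + -b i * b i₀) := by
            congr 1
            · funext j
              rw [show N kk j = M' i (Fin.castSucc j) from rfl, hM'ne i hii]
              ring
            · ring
          rw [heq, ← key]
          exact add_mem (mul_mem (intCast_mem _ _) (hu _)) (mul_mem (intCast_mem _ _) (hu _))
        | inr kk =>
          rw [matrixAct_xiV_inr P f]
          set i := Fin.succAbove i₀ kk with hi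
          have hii : i ≠ i₀ := Fin.succAbove_ne i₀ kk
          have key : wForm P f (fun j => M i (Fin.castSucc j)) (b i) ^ (b i₀) *
              wForm P f (fun j => M i₀ (Fin.castSucc j)) (b i₀) ^ (-b i) =
              wForm P f (fun j => b i₀ * M i (Fin.castSucc j) + -b i * M i₀ (Fin.castSucc j))
                (b i₀ * b i + -b i * b i₀) :=
            wForm_lin P f hxT hfξ _ _ _ _ _ _
          have heq : wForm P f (fun j => N kk j) 0 =
              wForm P f (fun j => b i₀ * M i (Fin.castSucc j) + -b i * M i₀ (Fin.castSucc j))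
                (b i₀ * b i + -b i * b i₀) := by
            congr 1
            · funext j
              rw [show N kk j = M' i (Fin.castSucc j) from rfl, hM'ne i hii]
              ring
            · ring
          rw [heq, ← key]
          exact mul_mem (zpow_mem (hw _) _) (zpow_mem (hw _) _)
      intro i
      simp only [Function.comp_apply]
      cases h : finSuccEquiv k i with
      | none => exact hu i₀
      | some j =>
        exact (Algebra.adjoin_le (S := KM.toSubalgebra) hN_coords) (hxmem j)

/-! ### The Rabinowitsch trick: conclusion -/

/-- **Density for `V = Z(P)`**: in an algebraically closed exponential field of characteristic
zero satisfying `Literature.NumberTheory.Transcendental.IsExpAlgClosed`, if `V = Z(P) ∩ Gⁿ` (`P` prime) is non-empty, of dimension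
`n`, free and rotund, then every polynomial vanishing on the Γ-points of `V` lies in `P`.
(If `f ∉ P` vanished on `V ∩ Γⁿ`, EAC applied to the Rabinowitsch variety `Z(Q) ⊆ G^{n+1}` —
irreducible, meeting the torus, of dimension `n + 1`, free and rotund by the results above, the
multiplicative freeness using the Γ-point of `V` provided by EAC in dimension `n` — would give a
Γ-point `(x, t ; eˣ, eᵗ)` of `Z(Q)`, whence a Γ-point `(x, eˣ)` of `V` with `f(x, eˣ) eᵗ = 1`,
contradicting `f(x, eˣ) = 0`.) [cite: BaysKirby2018ANT, Def. 10.3 (remark)] -/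
theorem vanishingIdeal_inter_expGraph_le [CharZero F] [Literature.ModelTheory.ExponentialFields.ExponentialRing F]
    (hEAC : IsExpAlgClosed F) (hne : (zeroLocus F P ∩ torusLocus F n).Nonempty)
    (hdim : zariskiDim F (zeroLocus F P) = n) (hadd : IsAddFree F n (zeroLocus F P ∩ torusLocus F n))
    (hmul : IsMulFree F n (zeroLocus F P ∩ torusLocus F n))
    (hrot : IsRotund F n (zeroLocus F P ∩ torusLocus F n)) :
    vanishingIdeal F (zeroLocus F P ∩ expGraph F n) ≤ P := by
  intro g hgI
  by_contra hg
  -- a Γ-point of `V`, a zero of `g`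
  obtain ⟨z₀, hz₀W, hz₀Γ⟩ :=
    hEAC n (zeroLocus F P) (isIrreducibleClosed_zeroLocus P) hne hrot hadd hmul hdim
  have hgz₀ : aeval z₀ g = 0 := (mem_vanishingIdeal_iff.1 hgI) z₀ ⟨hz₀W, hz₀Γ⟩
  have hz₀T : z₀ ∈ torusLocus F n := expGraph_subset_torusLocus hz₀Γ
  -- EAC for the Rabinowitsch variety in dimension `n + 1`
  obtain ⟨z, hzW, hzΓ⟩ := hEAC (n + 1) (zeroLocus F (rabIdeal P g))
    (isIrreducibleClosed_zeroLocus_rabIdeal P g) (nonempty_zeroLocus_rabIdeal P g hne hg)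
    (isRotund_zeroLocus_rabIdeal P g hne hg hrot) (isAddFree_zeroLocus_rabIdeal P g hne hg hadd)
    (isMulFree_zeroLocus_rabIdeal P g hne hg hmul ⟨z₀, ⟨hz₀W, hz₀T⟩, hgz₀⟩)
    (zariskiDim_zeroLocus_rabIdeal P g hdim)
  obtain ⟨hres, hrel⟩ := resPt_mem_of_mem_zeroLocus P g hg hzW
  have hresΓ : resPt z ∈ expGraph F n := fun i => hzΓ (Fin.castSucc i)
  have h0 : aeval (resPt z) g = 0 := (mem_vanishingIdeal_iff.1 hgI) _ ⟨hres, hresΓ⟩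
  rw [h0, mul_zero] at hrel
  exact zero_ne_one hrel

end Rabinowitsch

/-- An irreducible closed set is the zero set of its (prime) vanishing ideal. [folklore] -/
theorem IsIrreducibleClosed.exists_eq_zeroLocus {F : Type*} [Field F] {ι : Type*}
    {W : Set (ι → F)} (hW : IsIrreducibleClosed F W) :
    ∃ P : Ideal (MvPolynomial ι F), P.IsPrime ∧ W = zeroLocus F P := by
  obtain ⟨⟨I, rfl⟩, hprime⟩ := hW
  refine ⟨_, hprime, le_antisymm (zeroLocus_vanishingIdeal_le _) ?_⟩
  exact zeroLocus_anti_mono (le_vanishingIdeal_zeroLocus I)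

open GammaField Literature.ModelTheory.ExponentialFields.ExponentialRing in
/-- **Bays–Kirby 2018, Def. 10.3 (remark) — PROVED**: the named fact
`Literature.NumberTheory.Transcendental.BaysKirby2018_gammaPoints_dense_of_isExpAlgClosed` (EAC in the single-point form implies
Zariski density of the Γ-points in every irreducible free rotund `V ⊆ Gⁿ` of dimension `n`), by
the Rabinowitsch trick (`Rabinowitsch.vanishingIdeal_inter_expGraph_le`). Only algebraic
closedness of `F` is used, not the surjectivity of `exp`. [cite: BaysKirby2018ANT, Def. 10.3 (and the remark following it)] -/
theorem BaysKirby2018_gammaPoints_dense_of_isExpAlgClosed_holds :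
    BaysKirby2018_gammaPoints_dense_of_isExpAlgClosed.{u} := by
  intro F _ _ _ hF _ hEAC n W₀ hirr hne hdim hadd hmul hrot
  haveI := hF
  obtain ⟨P, hP, rfl⟩ := hirr.exists_eq_zeroLocus
  rw [MvPolynomial.IsPrime.vanishingIdeal_zeroLocus (K := F) P]
  exact Rabinowitsch.vanishingIdeal_inter_expGraph_le P hEAC hne hdim hadd hmul hrot

open GammaField Literature.ModelTheory.ExponentialFields.ExponentialRing in
/-- **Corollary: Γ-closed ⟹ GΓC — unconditionally in the density fact.** In a full,
exponentially-algebraically closed `F`, every `K` has `IsGenericallyGammaClosedOver K`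
(Bays–Kirby 2018, proof of Cor. 11.7). [cite: BaysKirby2018ANT, Cor. 11.7 (proof)] -/
theorem isGenericallyGammaClosedOver_of_isExpAlgClosed {F : Type u} [Field F] [CharZero F]
    [Literature.ModelTheory.ExponentialFields.ExponentialRing F] (hF : IsAlgClosed F) (hsurj : IsSurjectiveOntoUnits F)
    (hEAC : IsExpAlgClosed F) (K : Submodule ℚ F) : IsGenericallyGammaClosedOver K :=
  isGenericallyGammaClosedOver_of_dense K
    (BaysKirby2018_gammaPoints_dense_of_isExpAlgClosed_holds hF hsurj hEAC)

open GammaField Literature.ModelTheory.ExponentialFields.ExponentialRing in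
/-- **The saturation fact from Prop. 11.5 + Prop. 11.2 alone** (the density input being
proved). [cite: BaysKirby2018ANT, Cor. 11.7 (proof), Prop. 11.5, Prop. 11.2] -/
theorem BaysKirby2018_saturation_of_isExpAlgClosed_of_props
    (h5 : BaysKirby2018_prop_11_5.{u}) (h2 : BaysKirby2018_prop_11_2.{u}) :
    BaysKirby2018_saturation_of_isExpAlgClosed.{u} :=
  BaysKirby2018_saturation_of_isExpAlgClosed_of_facts
    BaysKirby2018_gammaPoints_dense_of_isExpAlgClosed_holds h5 h2

end Literature.NumberTheory.Transcendental
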